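import Mathlib
import HarnessLib
import HarnessLib.Audit
import Summits.ABC.ABC.Statement
import Literature.NumberTheory.EllipticCurves.LangHeightEC

/-!
Route: InterimTranscendEllArithS

CLOSED (closed) 2026-08-15T12:46:09Z by planner-ABC-route-ABC-InterimTranscendEllArithS-0 — reason: completed-in-literature: not a line of attack (consequence of the summit) — note: route-repair rrepair-ABC-InterimTranscendEllArithS-fff171fd (planner, 2026-08-15): CLOSED (closed_as=closed). (1) Content: the sole item stmt-ABC-0003 HindrySilverman : Literature.Abc.ABCConjecture -> LangHeightLowerBoundConjecture (abc => Lang's height lower bound, HindrySilverman1988 Thm 0.3 o Sil. The file is kept as the record of this route; refuted decls are indexed as negative knowledge (`ledger negatives`).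

Carry-over of the interim blast's sorried statements ABOUT ABC from interim group G06
TranscendEllArithS (Lang height / elliptic arithmetic) (Statements/Abc/LangHeightEC.lean; harness21
@ d8f2665). Thesis (to be sharpened by the route planner, D-0014e): the equivalences/implications
these 1 statements assert (hindry_silverman) hold and, combined, bear on ABC. They enter as
UNSTAMPED statement items: grounder first (most are cited results -> named facts in Literature),
then refuter, then provers.

Rationale: M5 migration (docs/m5/PLAN.md 2c‴ as amended by D-0014b): no workspace, no THESIS.md; the interim
decl text is in run/m5/workspaces/ for the operator and quoted in each item's --informal.

History (route lifecycle, newest last):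
- 2026-08-15T12:46:09Z · CLOSED closed — completed-in-literature: not a line of attack (consequence of the summit) (planner-ABC-route-ABC-InterimTranscendEllArithS-0)

sub-problem: ABC · status: closed(closed) · opened operator:999:2871182 2026-08-13T05:39:08Z · rev 0 · ledger route-ABC-InterimTranscendEllArithS
GENERATED by the gate from the ledger (D-0016/17). Provers cite these decls: `theorem foo : Summit.ABC.ABC.Theses.InterimTranscendEllArithS.<Decl> := …` in Summits/ABC/ABC/Theorems/<Name>.lean.
-/

namespace Summit.ABC.ABC.Theses.InterimTranscendEllArithS

open scoped BigOperators Topology Manifold Classical MeasureTheory ProbabilityTheory Matrix InnerProductSpace ComplexConjugate ContinuousMap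
open Filter Set Function TopologicalSpace MeasureTheory

attribute [summit_statement] _root_.ABC

open Literature.Abc

-- TODO item stmt-ABC-0003 · crux · rank 2 · closed · moot by None · by operator — BLOCKED: missing decl(s) Literature.Abc.ABCConjecture; restate via `ledger route edit` once they land:
--   def HindrySilverman : Prop := Literature.Abc.ABCConjecture → Literature.NumberTheory.EllipticCurves.LangHeightLowerBoundConjecture

end Summit.ABC.ABC.Theses.InterimTranscendEllArithS
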